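import Summits.ValiantsHypothesis.ValiantsHypothesis.Theorems.KPlusLogSqLawTridiagonalRealStaticUnitRows

/-!
# Route «KPlusLogSqLaw», crux `WeakLifting` (stmt-ValiantsHypothesis-19561) — REAL side of the tridiagonal sector:
# the UNIT-COEFFICIENT sub-sector — a ONE-SIGNED design of size 7 with FOUR positive zeros (the one-signed cap `⌊m/2⌋` fails at `m = 7`)

HONEST FRAMING.  Helper theorems (`--supports stmt-ValiantsHypothesis-19561 --as helper`), seat val-sym-lift-p1 (g19), cell `pub-symmetroid`,
2026-08-28; located companion of `…UnitMonotoneInertia` (p642748: for sizes `3,4,5,6,8` every one-signed unit design has at most `⌊m/2⌋` positive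
zeros).  SIZE 7 IS DIFFERENT: the unit design with diagonal exponents `d = (1,0,1,0,0,0,1)` and link exponents `f = (4,5,1,2,6,4)` has ALL EDGE
SLOPES POSITIVE, `L = (7, 9, 1, 4, 12, 7)`, and its determinant `D₇ = X³·Q`,
`Q = 1 − X − X⁴ − 2X⁷ + 2X⁸ − X⁹ + 2X¹¹ − X¹² + 2X¹³ + X¹⁴ − X¹⁵ + X¹⁶ − X¹⁸ + X¹⁹ − 2X²⁰ + X²¹`, has signs `+ − + − +` at `7/10, 4/5, 1, 3/2, 2`:
at least FOUR distinct positive zeros (`exists_unit_seven_oneSigned_four_le_card`; located exactly four by exact Sturm, two below and two ABOVE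
the resonance — the second zero above `1` is a DOWNWARD inertia crossing at the forced energy word `+ − + + − +` of `…UnitDominantRules`).
So «one-signed ⇒ `Z ≤ ⌊m/2⌋`» (true for `m ∈ {3,4,5,6,8}`, kernel) is FALSE at `m = 7`, and the Loewner-sector inertia law `Z ≤ ⌊m/2⌋` of
`…MonotonePencilInertia` (positive vertex-gauge rates, all `m`) does not extend to the whole one-signed class (the informal remark «every one-signed
unit design of size 7 has `≤ 3`» in the docstring of `…UnitRows.exists_unit_seven_four_le_card` is superseded by this witness).  Found by the seat's
random probe tools/m7_int_search.py (slopes ≤ 12; none with slopes ≤ 8 in 60 000 samples).  Nothing here is an upper law for the register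
(α NO MOVER); nothing bears on `WeakLifting` / `TropicalB` (stmt-19771) in their windows, Conjecture B, the Door-A registers, `MatrixDescartes`
(stmt-18050) or VP ≠ VNP.
[this seat; folklore: continuants ↔ matchings of the path, IVT sign certificates]
-/

-- `Summit.ValiantsHypothesis.ValiantsHypothesis.…` repeats a component by the D-0017 layout (single-conjunct summit); the name is mandated.
set_option linter.dupNamespace false
set_option autoImplicit false

namespace Summit.ValiantsHypothesis.ValiantsHypothesis.Theorems.KPlusLogSqLaw
namespace StaticTridiagonalRealUnit

open Polynomial Finset
open Summit.ValiantsHypothesis.ValiantsHypothesis.Theorems.KPlusLogSqLaw.StaticTridiagonalRealPotential (pathDet)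
open Summit.ValiantsHypothesis.ValiantsHypothesis.Theorems.SymmetroidDescartes (le_card_posRoots_of_alternating)

/-- the one-signed size-`7` design `d = (1,0,1,0,0,0,1)`, `f = (4,5,1,2,6,4)` (slopes `(7,9,1,4,12,7)`):
`D₇ = X³·(1 − X − X⁴ − 2X⁷ + 2X⁸ − X⁹ + 2X¹¹ − X¹² + 2X¹³ + X¹⁴ − X¹⁵ + X¹⁶ − X¹⁸ + X¹⁹ − 2X²⁰ + X²¹)`. [this file] -/
theorem eval_unit_seven_oneSigned (x : ℝ) :
    (pathDet (fun _ => (1 : ℝ)) (fun t => if t = 0 ∨ t = 2 ∨ t = 6 then 1 else 0) (fun _ => (1 : ℝ))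
        (fun t => if t = 0 then 4 else if t = 1 then 5 else if t = 2 then 1 else if t = 3 then 2 else if t = 4 then 6 else 4) 7).eval x =
      x ^ 3 * (1 - x - x ^ 4 - 2 * x ^ 7 + 2 * x ^ 8 - x ^ 9 + 2 * x ^ 11 - x ^ 12 + 2 * x ^ 13 + x ^ 14 - x ^ 15 + x ^ 16 - x ^ 18
        + x ^ 19 - 2 * x ^ 20 + x ^ 21) := by
  obtain ⟨e0, e1⟩ := eval_unit_zero_one (fun t => if t = 0 ∨ t = 2 ∨ t = 6 then 1 else 0)
    (fun t => if t = 0 then 4 else if t = 1 then 5 else if t = 2 then 1 else if t = 3 then 2 else if t = 4 then 6 else 4) x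
  have e := fun n => eval_unit_add_two (fun t => if t = 0 ∨ t = 2 ∨ t = 6 then 1 else 0)
    (fun t => if t = 0 then 4 else if t = 1 then 5 else if t = 2 then 1 else if t = 3 then 2 else if t = 4 then 6 else 4) x n
  have e2 := e 0
  have e3 := e 1
  have e4 := e 2
  have e5 := e 3
  have e6 := e 4
  have e7 := e 5
  simp only [zero_add] at e2
  rw [e7, e6, e5, e4, e3, e2, e1, e0]
  norm_num
  ring

/-- the slopes of the design are all positive: `d_k + d_{k+1} < 2f_k` for `k < 6`. [this file] -/
theorem slopes_pos_unit_seven_oneSigned :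
    ∀ k, k + 1 < 7 → (fun t : ℕ => if t = 0 ∨ t = 2 ∨ t = 6 then 1 else 0) k + (fun t : ℕ => if t = 0 ∨ t = 2 ∨ t = 6 then 1 else 0) (k + 1) <
      2 * (fun t : ℕ => if t = 0 then 4 else if t = 1 then 5 else if t = 2 then 1 else if t = 3 then 2 else if t = 4 then 6 else 4) k := by
  intro k hk
  have : k = 0 ∨ k = 1 ∨ k = 2 ∨ k = 3 ∨ k = 4 ∨ k = 5 := by omega
  rcases this with rfl | rfl | rfl | rfl | rfl | rfl <;> simp

/-- **A ONE-SIGNED SIZE-7 UNIT DESIGN WITH FOUR POSITIVE ZEROS**: there is a unit-coefficient static symmetric tridiagonal design of size `7` with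
ALL edge slopes positive and at least four distinct positive determinant zeros (signs `+ − + − +` at `7/10, 4/5, 1, 3/2, 2`; two of the zeros lie
above the resonance) — the one-signed cap `Z ≤ ⌊m/2⌋` of sizes `3,4,5,6,8` (`…UnitMonotoneInertia.card_posRoots_le_half`) fails at `m = 7`. [this file] -/
theorem exists_unit_seven_oneSigned_four_le_card :
    ∃ d f : ℕ → ℕ, (∀ k, k + 1 < 7 → d k + d (k + 1) < 2 * f k) ∧
      4 ≤ ((pathDet (fun _ => (1 : ℝ)) d (fun _ => (1 : ℝ)) f 7).roots.toFinset.filter (fun x => 0 < x)).card := by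
  refine ⟨fun t => if t = 0 ∨ t = 2 ∨ t = 6 then 1 else 0,
    fun t => if t = 0 then 4 else if t = 1 then 5 else if t = 2 then 1 else if t = 3 then 2 else if t = 4 then 6 else 4,
    slopes_pos_unit_seven_oneSigned, le_card_posRoots_of_alternating _ 4 (![7 / 10, 4 / 5, 1, 3 / 2, 2] : Fin 5 → ℝ) ?_ ?_ ?_⟩
  · refine Fin.strictMono_iff_lt_succ.2 fun j => ?_
    fin_cases j <;> norm_num [Matrix.cons_val_two, Matrix.tail_cons, Matrix.head_cons]
  · intro j; fin_cases j <;> norm_num [Matrix.cons_val_two, Matrix.tail_cons, Matrix.head_cons]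
  · intro j; fin_cases j <;> norm_num [Matrix.cons_val_two, Matrix.tail_cons, Matrix.head_cons, eval_unit_seven_oneSigned]

end StaticTridiagonalRealUnit
end Summit.ValiantsHypothesis.ValiantsHypothesis.Theorems.KPlusLogSqLaw
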